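import Literature.AlgebraicGeometry.Resolution.ArithmeticalThreefoldsDescentHeadFinalState
import HarnessLib

/-!
# Cossart–Piltant 2019, (511) from a nonsingular exponent matrix, and the final state with it

Topic: `Literature/AlgebraicGeometry/Resolution` (proofs only; no new notions, no new named
facts). `ArithmeticalThreefoldsMonomials.lean` proves Cossart–Piltant's "elementary linear
algebra" (511) (J. Algebra 529 (2019) = arXiv:1412.0868, proof of Prop. 4.8, arXiv v1 Prop. 4.6
p. 53: "there exists an `r × r` matrix `M`, `a = det M > 0` such that
`g_j := ∏ f_i^{m_{ij}} = δ̂_j û_j^a`") from the multiplicative INDEPENDENCE of the values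
`v(f_i)`, which it uses only to show that the exponent matrix of the monomials `f_i` is
nonsingular. The monoidal engine of Lemma 4.7 (`head_conclusion_of_principalized_within'`,
`Prop81MiddleAssemblyWithinDvd.lean`) exports exactly that: `f'_i = γ'_i ∏_j x'_j^{a'_{ij}}`
with `det a' ≠ 0`. This file proves (511) from the determinant and the corresponding form of
`exists_adjoin_isRegularLocalRing_of_lemma47State`:

* `CossartPiltantMonomial.exists_matrix_of_det_ne_zero` — group-theoretic core: `a = |det e|`,
  `m = sign(det e) adj(e)`, `∏ᵢ F_i^{m_{ji}} = (∏ᵢ C_i^{m_{ji}}) U_j^a`;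
* `CossartPiltantMonomial.exists_prod_zpow_eq_units_mul_pow_of_det_ne_zero` — in a field over a
  domain `S`: `∏ᵢ f_i^{m_{ji}} = c'_j u_j^a`, `c'_j ∈ Sˣ`;
* `exists_adjoin_isRegularLocalRing_of_lemma47State_of_det` — (LU) for `A` at `v` from the final
  state of Lemma 4.7 with the `fᵢ ∈ K` monomials of nonsingular exponent matrix, `m_A S ⊆ (∏ u)`,
  and the shape elements of (510).

## Sources

* V. Cossart, O. Piltant, J. Algebra 529 (2019) 268–535 = arXiv:1412.0868, proof of Prop. 4.8,
  Lemma 4.7 and (510)–(512) (arXiv v1: Prop. 4.6, pp. 52–53). [CossartPiltant2019]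
-/

noncomputable section

namespace Literature.AlgebraicGeometry.Resolution

universe u

open IsLocalRing

namespace CossartPiltantMonomial

/-- **(511) from a nonsingular exponent matrix, group-theoretic core.** In a commutative group
`G` let `F_i = C_i ∏_k U_k^{e_{ik}}` (`i, k ∈ ι`) with `det e ≠ 0`. Then for `a = |det e| > 0`
and `m = sign(det e) adj(e)`: `∏ᵢ F_i^{m_{ji}} = (∏ᵢ C_i^{m_{ji}}) U_j^a` for every `j`.
[cite: CossartPiltant2019, proof of Prop. 4.8 (arXiv v1: Prop. 4.6, p. 53), (511)] -/
theorem exists_matrix_of_det_ne_zero {G : Type*} [CommGroup G]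
    {ι : Type*} [Fintype ι] [DecidableEq ι] (U C F : ι → G) (e : ι → ι → ℤ)
    (hF : ∀ i, F i = C i * ∏ k, U k ^ e i k) (hdet : (Matrix.of e).det ≠ 0) :
    ∃ a : ℕ, 0 < a ∧ ∃ m : ι → ι → ℤ,
      ∀ j, ∏ i, F i ^ m j i = (∏ i, C i ^ m j i) * U j ^ (a : ℤ) := by
  set E : Matrix ι ι ℤ := Matrix.of e with hE
  -- `a = |det E|`, `m = sign (det E) • adj E`, `m E = a`
  set a : ℕ := E.det.natAbs with ha
  have ha0 : 0 < a := Int.natAbs_pos.mpr hdet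
  set m : ι → ι → ℤ := fun j i => E.det.sign * E.adjugate j i with hm
  have hmE : ∀ j k, ∑ i, m j i * e i k = if j = k then (a : ℤ) else 0 := fun j k => by
    have hadj := congr_fun (congr_fun (Matrix.adjugate_mul E) j) k
    rw [Matrix.mul_apply, Matrix.smul_apply, Matrix.one_apply, smul_eq_mul] at hadj
    have hadj' : ∑ i, E.adjugate j i * e i k = E.det * if j = k then 1 else 0 := by
      simpa [hE] using hadj
    simp only [hm, mul_assoc]
    rw [← Finset.mul_sum, hadj', ← mul_assoc, Int.sign_mul_self, ← ha]
    split_ifs <;> simp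
  refine ⟨a, ha0, m, fun j => ?_⟩
  calc ∏ i, F i ^ m j i = ∏ i, (C i ^ m j i * (∏ k, U k ^ e i k) ^ m j i) := by
        simp_rw [hF, mul_zpow]
    _ = (∏ i, C i ^ m j i) * ∏ i, (∏ k, U k ^ e i k) ^ m j i := Finset.prod_mul_distrib
    _ = (∏ i, C i ^ m j i) * ∏ k, U k ^ ∑ i, m j i * e i k := by rw [prod_prod_zpow_zpow]
    _ = (∏ i, C i ^ m j i) * U j ^ (a : ℤ) := by
        congr 1
        simp_rw [hmE]
        rw [Finset.prod_eq_single j (fun k _ hk => by rw [if_neg (Ne.symm hk), zpow_zero])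
          (fun h => absurd (Finset.mem_univ j) h), if_pos rfl]

/-- **(511) from a nonsingular exponent matrix, inside a field.** `S` a domain inside a field `L`,
`u_k ∈ S` nonzero, `f_i = c_i ∏_k u_k^{e_{ik}}` with `c_i ∈ Sˣ` and `det e ≠ 0` (as an integer
matrix). Then for some integer `a > 0`, integer matrix `m` and units `c'_j ∈ Sˣ`:
`∏ᵢ f_i^{m_{ji}} = c'_j u_j^a` in `L` for all `j`.
[cite: CossartPiltant2019, proof of Prop. 4.8 (arXiv v1: Prop. 4.6, p. 53), (511)] -/
theorem exists_prod_zpow_eq_units_mul_pow_of_det_ne_zero {S : Type*} [CommRing S] [IsDomain S]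
    {L : Type*} [Field L] [Algebra S L] (hSL : Function.Injective (algebraMap S L))
    {ι : Type*} [Fintype ι] [DecidableEq ι]
    (u : ι → S) (hu0 : ∀ k, u k ≠ 0) (f : ι → S) (c : ι → Sˣ) (e : ι → ι → ℕ)
    (hf : ∀ i, f i = c i * ∏ k, u k ^ e i k)
    (hdet : (Matrix.of fun i k => (e i k : ℤ)).det ≠ 0) :
    ∃ a : ℕ, 0 < a ∧ ∃ (m : ι → ι → ℤ) (c' : ι → Sˣ),
      ∀ j, ∏ i, algebraMap S L (f i) ^ m j i = algebraMap S L (c' j * u j ^ a) := by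
  set φ : S →* L := (algebraMap S L : S →* L) with hφ
  have hφ' : ∀ s, φ s = algebraMap S L s := fun _ => rfl
  have hU0 : ∀ k, algebraMap S L (u k) ≠ 0 := fun k => (map_ne_zero_iff _ hSL).mpr (hu0 k)
  set U : ι → Lˣ := fun k => Units.mk0 _ (hU0 k) with hU
  set C : ι → Lˣ := fun i => Units.map φ (c i) with hC
  set F : ι → Lˣ := fun i => C i * ∏ k, U k ^ (e i k : ℤ) with hF
  have hUval : ∀ k, (U k : L) = algebraMap S L (u k) := fun _ => rfl
  have hCval : ∀ i, (C i : L) = algebraMap S L (c i) := fun _ => rfl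
  have hFval : ∀ i, (F i : L) = algebraMap S L (f i) := fun i => by
    simp only [hF, Units.val_mul, Units.coe_prod, zpow_natCast, Units.val_pow_eq_pow_val, hUval,
      hCval, hf, map_mul, map_prod, map_pow]
  obtain ⟨a, ha, m, h511⟩ :=
    exists_matrix_of_det_ne_zero U C F (fun i k => (e i k : ℤ)) (fun i => rfl) hdet
  refine ⟨a, ha, m, fun j => ∏ i, c i ^ m j i, fun j => ?_⟩
  have h := congrArg (fun x : Lˣ => (x : L)) (h511 j)
  simp only [Units.val_mul, Units.coe_prod, Units.val_zpow_eq_zpow_val, hFval, zpow_natCast,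
    Units.val_pow_eq_pow_val, hUval] at h
  rw [h, map_mul, map_pow]
  congr 1
  change _ = φ _
  rw [← Units.coe_map, map_prod]
  simp only [map_zpow, Units.coe_prod, Units.val_zpow_eq_zpow_val, Units.coe_map, hφ', hCval]

end CossartPiltantMonomial

/-! ## The final state of Lemma 4.7 with a nonsingular exponent matrix -/

section Lemma47StateDet

variable {A : Type u} [CommRing A] [IsDomain A] [IsLocalRing A] [IsNoetherianRing A]
  {K : Type u} [Field K] [Algebra A K] [IsFractionRing A K]

/-- **(LU) for `A` at `v` from the final state of Lemma 4.7, exponent-matrix form.** As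
`exists_adjoin_isRegularLocalRing_of_lemma47State`, but the elements `f₁, …, f_r ∈ K` are given as
units times monomials in `u₁, …, u_r` with a NONSINGULAR exponent matrix (`det ≠ 0`) — the clause
exported by the monoidal engine `head_conclusion_of_principalized_within'` — instead of having
multiplicatively independent values. With `m_A S ⊆ (u₁ ⋯ u_r)` and the shape elements `b_i ∈ Â`
of the complementary parameters (from (510)), some finitely generated `A[t] ⊆ O` is regular at
the centre of `O`.
[cite: CossartPiltant2019, proof of Prop. 4.8 with Lemma 4.7 and (510)–(512) (arXiv v1: Prop. 4.6, pp. 52–53)] -/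
theorem exists_adjoin_isRegularLocalRing_of_lemma47State_of_det
    (k : Type u) [Field k] [Algebra k A] [Algebra.EssFiniteType k A]
    {K₁ : Type u} [Field K₁] [Algebra (AdicCompletion (maximalIdeal A) A) K₁]
    (hP₁ : RingHom.ker (algebraMap (AdicCompletion (maximalIdeal A) A) K₁) ∈
      minimalPrimes (AdicCompletion (maximalIdeal A) A))
    (hK₁ : ∀ z : K₁, ∃ a b : AdicCompletion (maximalIdeal A) A,
      z = algebraMap _ K₁ a / algebraMap _ K₁ b)
    (ι : K →+* K₁) (hι : ι.comp (algebraMap A K) =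
      (algebraMap (AdicCompletion (maximalIdeal A) A) K₁).comp
        (algebraMap A (AdicCompletion (maximalIdeal A) A)))
    (O' : ValuationSubring K₁)
    (halgO' : ∀ y : O', ∃ p : Polynomial (AdicCompletion (maximalIdeal A) A),
      (∃ i, p.coeff i ∉ (maximalIdeal A).map (algebraMap A (AdicCompletion (maximalIdeal A) A))) ∧
      O'.valuation (p.eval₂ (algebraMap (AdicCompletion (maximalIdeal A) A) K₁) y) < 1)
    (O : ValuationSubring K) (hO : O'.comap ι = O)
    -- the model
    {S : Type u} [CommRing S] [IsRegularLocalRing S]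
    [Algebra (AdicCompletion (maximalIdeal A) A) S]
    [IsLocalHom (algebraMap (AdicCompletion (maximalIdeal A) A) S)]
    [Algebra.EssFiniteType (AdicCompletion (maximalIdeal A) A) S] [Algebra S K₁]
    [IsScalarTower (AdicCompletion (maximalIdeal A) A) S K₁]
    (hSK₁ : Function.Injective (algebraMap S K₁))
    (hSO' : ∀ s : S, algebraMap S K₁ s ∈ O')
    (hdomS : ∀ s ∈ maximalIdeal S, O'.valuation (algebraMap S K₁ s) < 1)
    -- the final state of Lemma 4.7
    {r e : ℕ} (hr : 0 < r) (u : Fin r → S) (hu0 : ∀ j, u j ≠ 0) (x : Fin e → S)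
    (hspan : Ideal.span (Set.range u ∪ Set.range x) = maximalIdeal S)
    (hq : ∀ a ∈ maximalIdeal A, algebraMap (AdicCompletion (maximalIdeal A) A) S
      (algebraMap A (AdicCompletion (maximalIdeal A) A) a) ∈ Ideal.span {∏ j, u j})
    (f : Fin r → K) (γ : Fin r → Sˣ) (expo : Matrix (Fin r) (Fin r) ℕ)
    (hf : ∀ i, ι (f i) = algebraMap S K₁ (γ i * ∏ j, u j ^ expo i j))
    (hdet : (expo.map (fun n : ℕ => (n : ℤ))).det ≠ 0)
    -- the shape elements of (510)
    (bsh : Fin e → AdicCompletion (maximalIdeal A) A) (ε : Fin e → Sˣ) (m : Fin e → Fin r → ℕ)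
    (hbsh : ∀ i, algebraMap _ S (bsh i) = ε i * (∏ j, u j ^ m i j) * x i) :
    ∃ (t : Finset K) (h : (Algebra.adjoin A (t : Set K)).toSubring ≤ O.toSubring),
      IsRegularLocalRing (Localization.AtPrime
        (Ideal.comap (Subring.inclusion h) (maximalIdeal O))) := by
  classical
  haveI : IsDomain S := isDomain_of_isRegularLocalRing S
  -- the `A`-algebra structures on `K̂₁`, `S` and the `K`-algebra structure on `K̂₁` given by `ι`
  letI : Algebra A K₁ := ((algebraMap (AdicCompletion (maximalIdeal A) A) K₁).comp
    (algebraMap A (AdicCompletion (maximalIdeal A) A))).toAlgebra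
  haveI : IsScalarTower A (AdicCompletion (maximalIdeal A) A) K₁ :=
    IsScalarTower.of_algebraMap_eq fun _ => rfl
  letI : Algebra K K₁ := ι.toAlgebra
  have hιK : ∀ y : K, algebraMap K K₁ y = ι y := fun _ => rfl
  haveI : IsScalarTower A K K₁ :=
    IsScalarTower.of_algebraMap_eq fun y => (RingHom.congr_fun hι y).symm
  letI : Algebra A S := ((algebraMap (AdicCompletion (maximalIdeal A) A) S).comp
    (algebraMap A (AdicCompletion (maximalIdeal A) A))).toAlgebra
  haveI : IsScalarTower A (AdicCompletion (maximalIdeal A) A) S :=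
    IsScalarTower.of_algebraMap_eq fun _ => rfl
  haveI : IsScalarTower A S K₁ := IsScalarTower.of_algebraMap_eq fun y => by
    change (algebraMap (AdicCompletion (maximalIdeal A) A) K₁)
        (algebraMap A (AdicCompletion (maximalIdeal A) A) y) =
      algebraMap S K₁ ((algebraMap (AdicCompletion (maximalIdeal A) A) S)
        (algebraMap A (AdicCompletion (maximalIdeal A) A) y))
    rw [← IsScalarTower.algebraMap_apply (AdicCompletion (maximalIdeal A) A) S K₁]
  -- `m_A S ⊆ (u₁ ⋯ u_r)`
  have hq' : (maximalIdeal A).map (algebraMap A S) ≤ Ideal.span {∏ j, u j} := by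
    rw [Ideal.map_le_iff_le_comap]
    intro a ha
    exact hq a ha
  -- (511) from the determinant
  set fS : Fin r → S := fun i => (γ i : S) * ∏ j, u j ^ expo i j with hfSdef
  have hfS : ∀ i, ι (f i) = algebraMap S K₁ (fS i) := fun i => hf i
  have hdet' : (Matrix.of fun i k => (expo i k : ℤ)).det ≠ 0 := hdet
  obtain ⟨a, ha, mm, c', h511⟩ :=
    CossartPiltantMonomial.exists_prod_zpow_eq_units_mul_pow_of_det_ne_zero hSK₁ u hu0 fS γ
      (fun i k => expo i k) (fun _ => rfl) hdet'
  -- the `g_j ∈ K`, `j ≤ r`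
  set g : Fin r → K := fun j => ∏ i, f i ^ mm j i with hgdef
  have hg : ∀ j, algebraMap K K₁ (g j) = algebraMap S K₁ (c' j * u j ^ a) := fun j => by
    rw [← h511 j, hgdef]
    simp only [map_prod, map_zpow₀, hιK, hfS]
  -- (512) by density
  obtain ⟨z, hz, -, c, G, hG⟩ :=
    exists_rsp_powers_of_cp511_of_shape hSK₁ hr u hu0 x hspan hq' a c' g hg bsh ε m hbsh
  -- the end of the proof
  exact exists_adjoin_isRegularLocalRing_of_headData k hP₁ hK₁ ι hι O' halgO' O hO hSK₁ hSO'
    hdomS z hz (fun _ => a) (fun _ => ha) c G fun j => by rw [← hιK]; exact hG j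

end Lemma47StateDet

end Literature.AlgebraicGeometry.Resolution

end
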